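import Summits.CriticalPhenomena.PercolationContinuityZ3.Theorems.PercNearOneGluingNoHeavyLowerTailSahiThreeCopyPairHalfOr

/-!
# `NoHeavyLowerTail` (crux stmt-CriticalPhenomena-4575), Sahi programme: **THE GENERATED CLASS OF UNIVERSALLY GOOD PAIRS, WITH
# LITERAL PEELING** — closure of `UGen` (`…PairsClosure`) under the two half-literal steps of generation 56

Support file (Sahi cell, seat `prim-sahi-p1`, generation 56; `--supports stmt-CriticalPhenomena-4575`).  COMPUTATIONAL via the import
of `…PairsClosure` (base `≤ 4`).  An organising file: one inductive class and one theorem to cite.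

`UGenL n f g` is the smallest class of pairs of functions on cubes containing `UGen` (bases: pairs on `≤ 4` coordinates, nested pairs,
pairs with a cumulation member, block-independent pairs; closed under swap, lift, rename, blockwise monotone substitution) and closed
moreover under
* `andFree`: `(f, G¹) ∈ UGenL ⇒ (f ∧ x₀, G) ∈ UGenL` for EVERY nonnegative monotone `G` on the bigger cube (`…PairHalfAnd`),
* `orFree`:  `(f, G⁰) ∈ UGenL`, `f ≤ 1 ⇒ (f ∨ x₀, G) ∈ UGenL` for EVERY nonnegative monotone `G` (`…PairHalfOr`),
and again swap / lift / rename / substitution.  ★★ `UGenL.uGood`: every pair in the class is universally good, i.e. `c_b(f,g,H) ≥ 0`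
for every profile and every nonnegative monotone `H` (`UGenL.tc_nonneg`), hence Kahn's inequality `E₃^{coin q}(f,g,H) ≥ 0` under every
product measure with the third function ARBITRARY (`UGenL.sahiE_three_coin_nonneg`).  The literal steps of `…PairLiterals` /
`…PairOrLiterals` (literal on both members, or on one member with the other independent of it) are the special cases `G = g ∧ x₀`,
`g ∨ x₀`, `g` lifted.  In words: starting from any pair of increasing events on four common variables (or a nested / cylinder /
independent pair), one may repeatedly (i) rename or add idle variables, (ii) replace a common variable by an arbitrary increasing block
event on fresh variables, (iii) AND or OR a fresh variable onto ONE member while letting the OTHER member depend on that variable in an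
ARBITRARY increasing way — and Kahn's conjectured inequality holds for the resulting pair against every increasing third event.
Coverage (kit j334816, memo FROM-prim-sahi-p1-gen56 §3): the one-step reductions of this class settle 46.7 % of the 7581² ordered pairs of
up-sets of `{0,1}⁵` (37.8 % without `orFree`) and ≈ 19 % of random pairs on `{0,1}⁶`; the complement ("prime" pairs: no top-level literal
in either member, no common module, joint support `≥ 5`) is where the generic one-coordinate step — which has no linear certificate —
would be needed.  Nothing conjectural is used.  [this work]
-/

namespace Summit.CriticalPhenomena.PercolationContinuityZ3.Theorems.SahiThreeCopy

open Finset Function Literature.Combinatorics.Sahi2008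
open scoped BigOperators

noncomputable section

variable {d : ℕ}

/-- The generated class with literal peeling (see the module docstring). [this work] -/
inductive UGenL : (n : ℕ) → (Pt n → ℝ) → (Pt n → ℝ) → Prop
  | ofUGen {n : ℕ} {f g : Pt n → ℝ} (h : UGen n f g) : UGenL n f g
  | symm {n : ℕ} {f g : Pt n → ℝ} (h : UGenL n f g) : UGenL n g f
  | lift {d : ℕ} {f g : Pt d → ℝ} (h : UGenL d f g) (m : ℕ) : UGenL (d + m) (liftB m f) (liftB m g)
  | rename {n : ℕ} {f g : Pt n → ℝ} (h : UGenL n f g) (τ : Fin n ≃ Fin n) :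
      UGenL n (fun x => f (rePt τ x)) (fun x => g (rePt τ x))
  | subst {d : ℕ} {f g : Pt (d + 1) → ℝ} (h : UGenL (d + 1) f g) (e : ℕ) {σ : Pt e → Bool} (hσ : Monotone σ) :
      UGenL (d + e) (SahiThreeCopy.subst e σ f) (SahiThreeCopy.subst e σ g)
  | andFree {d : ℕ} {f : Pt d → ℝ} {G : Pt (d + 1) → ℝ} (h : UGenL d f (sec G true)) (hG : ∀ w, 0 ≤ G w) (hGm : Monotone G) :
      UGenL (d + 1) (SahiThreeCopy.andAdj true f) G
  | orFree {d : ℕ} {f : Pt d → ℝ} {G : Pt (d + 1) → ℝ} (h : UGenL d f (sec G false)) (hf1 : ∀ x, f x ≤ 1) (hG : ∀ w, 0 ≤ G w)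
      (hGm : Monotone G) : UGenL (d + 1) (SahiThreeCopy.orAdj true f) G

/-- ★★ **Every pair in the class `UGenL` is universally good.** [this work] -/
theorem UGenL.uGood {n : ℕ} {f g : Pt n → ℝ} (h : UGenL n f g) : UGood f g := by
  induction h with
  | ofUGen h => exact h.uGood
  | symm _ ih => exact ih.symm
  | lift _ m ih => exact ih.liftB m
  | rename _ τ ih => exact ih.rePt τ
  | subst _ e hσ ih => exact ih.subst e hσ
  | andFree _ hG hGm ih => exact ih.andAdj_free hG hGm
  | orFree _ hf1 hG hGm ih => exact ih.orAdj_free hf1 hG hGm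

/-- The coefficient statement: `0 ≤ c_b(f,g,H)` for `(f,g) ∈ UGenL`, every profile and every nonnegative monotone `H`. [this work] -/
theorem UGenL.tc_nonneg {n : ℕ} {f g : Pt n → ℝ} (h : UGenL n f g) {H : Pt n → ℝ} (hH : ∀ x, 0 ≤ H x) (hHm : Monotone H)
    (b : Fin n → ℕ) : 0 ≤ tc b f g H :=
  h.uGood.2.2.2.2 b H hH hHm

/-- **Law level (Kahn's Conjecture 5 for the class `UGenL`, third event arbitrary)**: `E₃^{coin q}(f,g,H) ≥ 0` under every product
measure. [this work] -/
theorem UGenL.sahiE_three_coin_nonneg {n : ℕ} {f g : Pt n → ℝ} (h : UGenL n f g) {q : Fin n → ℝ}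
    (hq : ∀ i, 0 ≤ q i ∧ q i ≤ 1) {H : Pt n → ℝ} (hH : ∀ x, 0 ≤ H x) (hHm : Monotone H) :
    0 ≤ sahiE (coinWeight q) 3 ![f, g, H] :=
  sahiE_three_coin_nonneg_of_tc hq fun b => h.tc_nonneg hH hHm b

/-! ### Derived steps: the literal-on-both-members cases are inside the class -/

/-- `(f ∧ x₀, g ∧ x₀)` from `(f,g)` (the case of `…PairLiterals`): `andFree` with `G = g ∧ x₀`, `G¹ = g`. [this work] -/
theorem UGenL.andBoth {f g : Pt d → ℝ} (h : UGenL d f g) (hg : ∀ x, 0 ≤ g x) (hgm : Monotone g) :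
    UGenL (d + 1) (SahiThreeCopy.andAdj true f) (SahiThreeCopy.andAdj true g) := by
  have h' : UGenL d f (sec (SahiThreeCopy.andAdj true g) true) := by rw [sec_andAdj_true_true]; exact h
  exact h'.andFree (andAdj_nonneg true hg) (andAdj_monotone true hg hgm)

/-- `(f ∨ x₀, g ∨ x₀)` from `(f,g)` (`…PairOrLiterals`): `orFree` with `G = g ∨ x₀`, `G⁰ = g`. [this work] -/
theorem UGenL.orBoth {f g : Pt d → ℝ} (h : UGenL d f g) (hf1 : ∀ x, f x ≤ 1) (hg : ∀ x, 0 ≤ g x) (hg1 : ∀ x, g x ≤ 1)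
    (hgm : Monotone g) : UGenL (d + 1) (SahiThreeCopy.orAdj true f) (SahiThreeCopy.orAdj true g) := by
  have h' : UGenL d f (sec (SahiThreeCopy.orAdj true g) false) := by rw [sec_orAdj_true_false]; exact h
  exact h'.orFree hf1 (orAdj_nonneg true hg) (orAdj_monotone true hg1 hgm)

/-- `(f ∧ x₀, g ∨ x₀)` for ANY nonnegative monotone `f, g` (`g ≤ 1`): `andFree` with `G = g ∨ x₀`, `G¹ = 1` and the nested
base `(f, 1)`. [this work] -/
theorem UGenL.andOr {f g : Pt d → ℝ} (hf : ∀ x, 0 ≤ f x) (hfm : Monotone f) (hg : ∀ x, 0 ≤ g x) (hg1 : ∀ x, g x ≤ 1)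
    (hgm : Monotone g) : UGenL (d + 1) (SahiThreeCopy.andAdj true f) (SahiThreeCopy.orAdj true g) := by
  have h1 : UGenL d f 1 :=
    UGenL.ofUGen (UGen.nested hf hfm (fun _ => zero_le_one) monotone_const (mul_one f) fun _ => le_rfl)
  have h' : UGenL d f (sec (SahiThreeCopy.orAdj true g) true) := by rw [sec_orAdj_true_true]; exact h1
  exact h'.andFree (orAdj_nonneg true hg) (orAdj_monotone true hg1 hgm)

end

end Summit.CriticalPhenomena.PercolationContinuityZ3.Theorems.SahiThreeCopy
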